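import Literature.Topology.FourManifolds.SeamTube
import Literature.Topology.FourManifolds.CollarGermExtension
import HarnessLib

/-!
# The collar germs of the comparison map between two gluings

Sixth file of the proof of the tree's named fact
`Literature.Topology.FourManifolds.nonempty_diffeomorph_of_isBoundaryGluing` (`Gluing.lean`;
Hirsch (1976), Ch. 8, Thm. 2.1 / Thm. 1.9; Bröcker–Jänich (1982), (13.9) with (13.7)).

Let `G`, `G'` be gluing data of the same compact Hausdorff pieces `M`, `N` along the same
identification, with glued manifolds `P`, `P'`, comparison homeomorphism `F = G.compare G'`
(`jA a ↦ jA' a`, `jB b ↦ jB' b`; a diffeomorphism off the seam, `BoundaryGluingData.lean`) and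
seam tubes `T : ∂M × (-ε, ε) ≅ {|f| < ε} ⊆ P`, `T'` likewise for `P'` (`SeamTube.lean`).  In tube
coordinates the comparison map is the germ `Ψ̂ = T'⁻¹ ∘ F ∘ T` of a homeomorphism of the
cylinder `∂M × ℝ` along `∂M × {0}`, smooth with smooth inverse `Γ̂ = T⁻¹ ∘ F⁻¹ ∘ T'` on each
*closed* side, but in general not across the zero level (this crease is the whole content of
the uniqueness of gluings).  This file packages the two one-sided germs as collar germs in the
sense of `CollarGerm.lean`:

* `ComparisonFrame`: the smallness constants `b`, `δ` of the construction
  (`exists_comparisonFrame`, compactness);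
* `ComparisonFrame.germUp`: the upper germ `(Γ̂, Ψ̂)` on `∂M × [0, δ)`, with height the
  two-sided extension `g̃₊ ∘ T'` of `f ∘ F⁻¹ ∘ T'`, where `g̃₊ : P' → ℝ` extends `f ∘ jA ∘ jA'⁻¹`
  across the seam of `P'` (`BoundaryGluingData.exists_contMDiff_comp_jA_eq`, Seeley);
* `ComparisonFrame.germDown`: the lower germ, conjugated by the reflection `(x, t) ↦ (x, -t)`
  into the upper half cylinder.

The extension theorem `CollarGerm.exists_extension` (uniqueness of collars) applied to the two
germs, and the resulting diffeomorphism `P ≅ P'`, are in `GluingSmoothing.lean`.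

Everything here is proved; no named facts are introduced.

## References

* M. W. Hirsch, *Differential Topology*, GTM 33 (1976), Ch. 8 §1, proof of Thm. 1.9.
  [HirschDT1976]
* Th. Bröcker, K. Jänich, *Introduction to Differential Topology* (1982), (13.7)–(13.9).
  [BrockerJanich1982]
-/

open scoped Manifold ContDiff Topology
open Set Function Metric Filter Topology

noncomputable section

namespace Literature.Topology.FourManifolds

universe u v w

/-- Local notation: `𝔼 n` is the model Euclidean space `EuclideanSpace ℝ (Fin n)`. -/
local notation "𝔼 " n:arg => EuclideanSpace ℝ (Fin n)
/-- Local notation: `ℍ n` is the closed half space `EuclideanHalfSpace n`. -/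
local notation "ℍ " n:arg => EuclideanHalfSpace n

namespace BoundaryGluingData

variable {n : ℕ} {M N : Type u} [TopologicalSpace M] [ChartedSpace (ℍ (n + 1)) M]
  [TopologicalSpace N] [ChartedSpace (ℍ (n + 1)) N]
  {bM : BoundaryData (𝓡∂ (n + 1)) M (𝓡 n)} {bN : BoundaryData (𝓡∂ (n + 1)) N (𝓡 n)}
  {φ : bM.carrier ≃ bN.carrier}
  {P : Type v} [TopologicalSpace P] [ChartedSpace (𝔼 (n + 1)) P]
  {P' : Type w} [TopologicalSpace P'] [ChartedSpace (𝔼 (n + 1)) P']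
  {G : BoundaryGluingData bM bN φ P} {G' : BoundaryGluingData bM bN φ P'}

/-! ### The two-sided germs in tube coordinates -/

section Germs

variable (T : G.SeamTube) (T' : G'.SeamTube)

/-- **The comparison map in tube coordinates**, `Ψ̂ = T'⁻¹ ∘ F ∘ T` (meaningful on
`∂M × (-δ, δ)` for small `δ`). [folklore] -/
def psiHat (q : bM.carrier × ℝ) : bM.carrier × ℝ := T'.invFun (G.compare G' (T.toFun q))

/-- **Its inverse in tube coordinates**, `Γ̂ = T⁻¹ ∘ F⁻¹ ∘ T'`. [folklore] -/
def gamHat (q : bM.carrier × ℝ) : bM.carrier × ℝ := T.invFun (G'.compare G (T'.toFun q))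

/-- The reflection `(x, t) ↦ (x, -t)` of the cylinder. [folklore] -/
def reflT (q : bM.carrier × ℝ) : bM.carrier × ℝ := (q.1, -q.2)

/-- The reflection is an involution. [folklore] -/
@[simp] theorem reflT_reflT (q : bM.carrier × ℝ) : reflT (bM := bM) (reflT q) = q := by
  simp [reflT]

/-- Components of the reflection (definitional). [folklore] -/
@[simp] theorem reflT_apply (x : bM.carrier) (t : ℝ) : reflT (bM := bM) (x, t) = (x, -t) := rfl

/-- The reflection is smooth. [folklore] -/
theorem contMDiff_reflT : ContMDiff ((𝓡 n).prod 𝓘(ℝ, ℝ)) ((𝓡 n).prod 𝓘(ℝ, ℝ)) ∞ (reflT (bM := bM)) :=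
  contMDiff_fst.prodMk (contDiff_neg.comp_contMDiff contMDiff_snd)

/-- The second component of `Γ̂` is the height `f ∘ F⁻¹ ∘ T'`. [folklore] -/
theorem gamHat_snd (q : bM.carrier × ℝ) : (gamHat T T' q).2 = T.height (G'.compare G (T'.toFun q)) :=
  T.invFun_snd _

/-- The second component of `Ψ̂` is the height `f' ∘ F ∘ T`. [folklore] -/
theorem psiHat_snd (q : bM.carrier × ℝ) : (psiHat T T' q).2 = T'.height (G.compare G' (T.toFun q)) :=
  T'.invFun_snd _

/-- `Γ̂` fixes the zero level. [folklore] -/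
theorem gamHat_zero (x : bM.carrier) : gamHat T T' (x, 0) = (x, 0) := by
  simp only [gamHat, T'.toFun_zero, compare_jA, T.invFun_seamPoint]

/-- `Ψ̂` fixes the zero level. [folklore] -/
theorem psiHat_zero (x : bM.carrier) : psiHat T T' (x, 0) = (x, 0) := by
  simp only [psiHat, T.toFun_zero, compare_jA, T'.invFun_seamPoint]

end Germs

/-! ### The smallness constants -/

/-- **The constants of the smoothing construction.** A level `b ∈ (0, ε']` in `P'` and a width
`δ ∈ (0, min ε ε']` of the germ slabs such that: points of `P` whose image under `F` has
`|f'| < b` lie in the tube `{|f| < ε}` of `P`; the slab `∂M × (-δ, δ)` is carried by `F ∘ T` into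
`{|f'| < b}` and by `F⁻¹ ∘ T'` into `{|f| < ε}`; and points `p'` of `P'` with `|f (F⁻¹ p')| < δ`
have `|f' p'| < b`.  Existence: `exists_comparisonFrame` (compactness). [folklore] -/
structure ComparisonFrame (T : G.SeamTube) (T' : G'.SeamTube) where
  /-- The level in `P'`. -/
  b : ℝ
  /-- The width of the germ slabs. -/
  δ : ℝ
  b_pos : 0 < b
  b_le : b ≤ T'.ε
  δ_pos : 0 < δ
  δ_le : δ ≤ T.ε
  δ_le' : δ ≤ T'.ε
  δ_le_b : δ ≤ b
  /-- `|f' (F p)| < b ⟹ |f p| < ε`. -/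
  height_mem_of : ∀ p : P, T'.height (G.compare G' p) ∈ Ioo (-b) b → T.height p ∈ Ioo (-T.ε) T.ε
  /-- The slab is carried by `F ∘ T` into `{|f'| < b}`. -/
  slab_fwd : ∀ q : bM.carrier × ℝ, q.2 ∈ Ioo (-δ) δ → T'.height (G.compare G' (T.toFun q)) ∈ Ioo (-b) b
  /-- The slab is carried by `F⁻¹ ∘ T'` into `{|f| < ε}`. -/
  slab_bwd : ∀ q : bM.carrier × ℝ, q.2 ∈ Ioo (-δ) δ →
    T.height (G'.compare G (T'.toFun q)) ∈ Ioo (-T.ε) T.ε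
  /-- `|f (F⁻¹ p')| < δ ⟹ |f' p'| < b`. -/
  height_mem_of' : ∀ p' : P', T.height (G'.compare G p') ∈ Ioo (-δ) δ → T'.height p' ∈ Ioo (-b) b

section Frame

variable [T2Space M] [T2Space N] [CompactSpace M] [CompactSpace N]
  [IsManifold (𝓡∂ (n + 1)) ∞ M] [IsManifold (𝓡∂ (n + 1)) ∞ N] [IsManifold (𝓡 (n + 1)) ∞ P]
  [IsManifold (𝓡 (n + 1)) ∞ P'] (T : G.SeamTube) (T' : G'.SeamTube)

omit [T2Space M] [T2Space N] [CompactSpace M] [CompactSpace N] [IsManifold (𝓡 (n + 1)) ∞ P'] in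
/-- **A positive level separating a compact set off the seam from the seam**: if `C ⊆ P` is
compact and disjoint from the seam, then `|f' ∘ F| ≥ b` on `C` for some `b > 0`. [folklore] -/
theorem exists_pos_le_abs_height_compare {C : Set P} (hC : IsCompact C) (hCs : Disjoint C G.seam) :
    ∃ b > 0, ∀ p ∈ C, b ≤ |T'.height (G.compare G' p)| := by
  rcases C.eq_empty_or_nonempty with rfl | hne
  · exact ⟨1, one_pos, fun p hp => hp.elim⟩
  have hcont : Continuous fun p : P => |T'.height (G.compare G' p)| :=
    continuous_abs.comp (T'.contMDiff_height.continuous.comp (G.continuous_compare G'))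
  obtain ⟨p₀, hp₀, hmin⟩ := hC.exists_isMinOn hne hcont.continuousOn
  refine ⟨|T'.height (G.compare G' p₀)|, abs_pos.2 fun h0 => ?_, fun p hp => isMinOn_iff.1 hmin p hp⟩
  have : G.compare G' p₀ ∈ G'.seam := (T'.height_eq_zero_iff _).1 h0
  rw [G.compare_mem_seam_iff G'] at this
  exact Set.disjoint_left.1 hCs hp₀ this

omit [T2Space M] [T2Space N] in
/-- **Comparison frames exist.** [folklore] -/
theorem exists_comparisonFrame [Nonempty bM.carrier] : Nonempty (ComparisonFrame T T') := by
  haveI := G.compactSpace; haveI := G'.compactSpace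
  haveI : CompactSpace bM.carrier := bM.compactSpace_carrier
  -- (1) the level `b`
  have hC : IsCompact (T.height ⁻¹' (Ioo (-T.ε) T.ε)ᶜ) :=
    (isOpen_Ioo.preimage T.contMDiff_height.continuous).isClosed_compl.isCompact
  have hCs : Disjoint (T.height ⁻¹' (Ioo (-T.ε) T.ε)ᶜ) G.seam :=
    Set.disjoint_left.2 fun p hp hs => hp (T.mem_tube_of_mem_seam hs)
  obtain ⟨b₀, hb₀, hb₀C⟩ := exists_pos_le_abs_height_compare T' (G := G) hC hCs
  set b := min b₀ T'.ε with hb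
  have hbpos : 0 < b := lt_min hb₀ T'.ε_pos
  have hmem_of : ∀ p : P, T'.height (G.compare G' p) ∈ Ioo (-b) b → T.height p ∈ Ioo (-T.ε) T.ε := by
    intro p hp
    by_contra h
    have := hb₀C p h
    have hlt : |T'.height (G.compare G' p)| < b₀ := (abs_lt.2 ⟨hp.1, hp.2⟩).trans_le (min_le_left _ _)
    linarith
  -- (2) the level `δ₀` from the side of `P'`
  have hC' : IsCompact (T'.height ⁻¹' (Ioo (-b) b)ᶜ) :=
    (isOpen_Ioo.preimage T'.contMDiff_height.continuous).isClosed_compl.isCompact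
  have hCs' : Disjoint (T'.height ⁻¹' (Ioo (-b) b)ᶜ) G'.seam :=
    Set.disjoint_left.2 fun p hp hs => hp (show T'.height p ∈ Ioo (-b) b by
      rw [(T'.height_eq_zero_iff _).2 hs]; exact ⟨by linarith, hbpos⟩)
  obtain ⟨δ₀, hδ₀, hδ₀C⟩ := exists_pos_le_abs_height_compare T (G := G') (G' := G) hC' hCs'
  -- (3) the slab conditions, by the tube lemma
  have hW₁ : IsOpen ((fun q : bM.carrier × ℝ => T'.height (G.compare G' (T.toFun q))) ⁻¹' Ioo (-b) b) :=
    isOpen_Ioo.preimage (T'.contMDiff_height.continuous.comp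
      ((G.continuous_compare G').comp T.contMDiff_toFun.continuous))
  obtain ⟨u₁, hu₁, hsub₁⟩ := exists_prod_Ioo_subset_of_isOpen hW₁ (fun x => by
    show T'.height (G.compare G' (T.toFun (x, 0))) ∈ Ioo (-b) b
    rw [T.toFun_zero, compare_jA, (T'.height_eq_zero_iff _).2 (G'.jA_incl_mem_seam x)]
    exact ⟨by linarith, hbpos⟩)
  have hW₂ : IsOpen ((fun q : bM.carrier × ℝ => T.height (G'.compare G (T'.toFun q))) ⁻¹'
      Ioo (-T.ε) T.ε) :=
    isOpen_Ioo.preimage (T.contMDiff_height.continuous.comp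
      ((G'.continuous_compare G).comp T'.contMDiff_toFun.continuous))
  obtain ⟨u₂, hu₂, hsub₂⟩ := exists_prod_Ioo_subset_of_isOpen hW₂ (fun x => by
    show T.height (G'.compare G (T'.toFun (x, 0))) ∈ Ioo (-T.ε) T.ε
    rw [T'.toFun_zero, compare_jA, (T.height_eq_zero_iff _).2 (G.jA_incl_mem_seam x)]
    exact ⟨by linarith [T.ε_pos], T.ε_pos⟩)
  set δ := min (min (min δ₀ u₁) (min u₂ (min T.ε T'.ε))) b with hδ
  have hδpos : 0 < δ := lt_min (lt_min (lt_min hδ₀ hu₁) (lt_min hu₂ (lt_min T.ε_pos T'.ε_pos))) hbpos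
  have hδ₀' : δ ≤ δ₀ := (min_le_left _ _).trans ((min_le_left _ _).trans (min_le_left _ _))
  have hδu₁ : δ ≤ u₁ := (min_le_left _ _).trans ((min_le_left _ _).trans (min_le_right _ _))
  have hδu₂ : δ ≤ u₂ := (min_le_left _ _).trans ((min_le_right _ _).trans (min_le_left _ _))
  have hδε : δ ≤ T.ε :=
    (min_le_left _ _).trans ((min_le_right _ _).trans ((min_le_right _ _).trans (min_le_left _ _)))
  have hδε' : δ ≤ T'.ε :=
    (min_le_left _ _).trans ((min_le_right _ _).trans ((min_le_right _ _).trans (min_le_right _ _)))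
  refine ⟨{ b := b, δ := δ, b_pos := hbpos, b_le := min_le_right _ _, δ_pos := hδpos, δ_le := hδε,
            δ_le' := hδε', δ_le_b := min_le_right _ _, height_mem_of := hmem_of,
            slab_fwd := fun q hq => hsub₁ ⟨mem_univ _, ?_⟩,
            slab_bwd := fun q hq => hsub₂ ⟨mem_univ _, ?_⟩,
            height_mem_of' := fun p' hp' => ?_ }⟩
  · exact ⟨by linarith [hq.1], hq.2.trans_le hδu₁⟩
  · exact ⟨by linarith [hq.1], hq.2.trans_le hδu₂⟩
  · by_contra h
    have := hδ₀C p' h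
    have hlt : |T.height (G'.compare G p')| < δ₀ := (abs_lt.2 ⟨hp'.1, hp'.2⟩).trans_le hδ₀'
    linarith

end Frame

/-! ### The germs as collar germs -/

section GermConstruction

variable [T2Space M] [T2Space N] [CompactSpace M] [CompactSpace N]
  [IsManifold (𝓡∂ (n + 1)) ∞ M] [IsManifold (𝓡∂ (n + 1)) ∞ N] [IsManifold (𝓡 (n + 1)) ∞ P]
  [IsManifold (𝓡 (n + 1)) ∞ P'] {T : G.SeamTube} {T' : G'.SeamTube} (Fr : ComparisonFrame T T')

namespace ComparisonFrame

omit [T2Space M] [T2Space N] [CompactSpace M] [CompactSpace N] [IsManifold (𝓡∂ (n + 1)) ∞ M]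
  [IsManifold (𝓡∂ (n + 1)) ∞ N] [IsManifold (𝓡 (n + 1)) ∞ P] [IsManifold (𝓡 (n + 1)) ∞ P'] in
/-- `[0, δ) ⊆ (-δ, δ)`. [folklore] -/
theorem mem_Ioo_of_mem_Ico {t : ℝ} (ht : t ∈ Ico 0 Fr.δ) : t ∈ Ioo (-Fr.δ) Fr.δ :=
  ⟨by linarith [ht.1, Fr.δ_pos], ht.2⟩

omit [T2Space M] [T2Space N] [CompactSpace M] [CompactSpace N] [IsManifold (𝓡∂ (n + 1)) ∞ M]
  [IsManifold (𝓡∂ (n + 1)) ∞ N] [IsManifold (𝓡 (n + 1)) ∞ P] [IsManifold (𝓡 (n + 1)) ∞ P'] in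
/-- `(-δ, 0] ⊆ (-δ, δ)`. [folklore] -/
theorem mem_Ioo_of_mem_Ioc {t : ℝ} (ht : t ∈ Ioc (-Fr.δ) 0) : t ∈ Ioo (-Fr.δ) Fr.δ :=
  ⟨ht.1, ht.2.trans_lt Fr.δ_pos⟩

omit [T2Space M] [T2Space N] [CompactSpace M] [CompactSpace N] [IsManifold (𝓡∂ (n + 1)) ∞ M]
  [IsManifold (𝓡∂ (n + 1)) ∞ N] [IsManifold (𝓡 (n + 1)) ∞ P] [IsManifold (𝓡 (n + 1)) ∞ P'] in
/-- The upper slab of `T'` lies in the first piece of `P'`. [folklore] -/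
theorem toFun'_mem_range_jA (x : bM.carrier) {t : ℝ} (ht : t ∈ Ico 0 Fr.δ) :
    T'.toFun (x, t) ∈ range G'.jA :=
  T'.toFun_mem_range_jA x ⟨ht.1, ht.2.trans_le Fr.δ_le'⟩

omit [T2Space M] [T2Space N] [CompactSpace M] [CompactSpace N] [IsManifold (𝓡∂ (n + 1)) ∞ M]
  [IsManifold (𝓡∂ (n + 1)) ∞ N] [IsManifold (𝓡 (n + 1)) ∞ P] [IsManifold (𝓡 (n + 1)) ∞ P'] in
/-- The upper slab of width `b` of `T'` lies in the first piece of `P'`. [folklore] -/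
theorem toFun'_mem_range_jA_b (x : bM.carrier) {t : ℝ} (ht : t ∈ Ico 0 Fr.b) :
    T'.toFun (x, t) ∈ range G'.jA :=
  T'.toFun_mem_range_jA x ⟨ht.1, ht.2.trans_le Fr.b_le⟩

omit [T2Space M] [T2Space N] [CompactSpace M] [CompactSpace N] [IsManifold (𝓡∂ (n + 1)) ∞ M]
  [IsManifold (𝓡∂ (n + 1)) ∞ N] [IsManifold (𝓡 (n + 1)) ∞ P] [IsManifold (𝓡 (n + 1)) ∞ P'] in
/-- The lower slab of width `b` of `T'` lies in the second piece of `P'`. [folklore] -/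
theorem toFun'_mem_range_jB_b (x : bM.carrier) {t : ℝ} (ht : t ∈ Ioc (-Fr.b) 0) :
    T'.toFun (x, t) ∈ range G'.jB :=
  T'.toFun_mem_range_jB x ⟨by linarith [ht.1, Fr.b_le], ht.2⟩

omit [T2Space M] [T2Space N] [CompactSpace M] [CompactSpace N] [IsManifold (𝓡∂ (n + 1)) ∞ M]
  [IsManifold (𝓡∂ (n + 1)) ∞ N] [IsManifold (𝓡 (n + 1)) ∞ P] [IsManifold (𝓡 (n + 1)) ∞ P'] in
/-- **Points of the `b`-slab of `T'` are carried by `F⁻¹` into the tube of `T`.** [folklore] -/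
theorem height_compare'_toFun' {q : bM.carrier × ℝ} (hq : q.2 ∈ Ioo (-Fr.b) Fr.b) :
    T.height (G'.compare G (T'.toFun q)) ∈ Ioo (-T.ε) T.ε := by
  refine Fr.height_mem_of _ ?_
  rw [compare_compare, show q = (q.1, q.2) from rfl,
    T'.height_toFun q.1 q.2 ⟨by linarith [hq.1, Fr.b_le], hq.2.trans_le Fr.b_le⟩]
  exact hq

omit [T2Space M] [T2Space N] [CompactSpace M] [CompactSpace N] [IsManifold (𝓡∂ (n + 1)) ∞ M]
  [IsManifold (𝓡∂ (n + 1)) ∞ N] [IsManifold (𝓡 (n + 1)) ∞ P] [IsManifold (𝓡 (n + 1)) ∞ P'] in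
/-- The upper slab of `T` lies in the first piece of `P`. [folklore] -/
theorem toFun_mem_range_jA (x : bM.carrier) {t : ℝ} (ht : t ∈ Ico 0 Fr.δ) :
    T.toFun (x, t) ∈ range G.jA :=
  T.toFun_mem_range_jA x ⟨ht.1, ht.2.trans_le Fr.δ_le⟩

omit [T2Space M] [T2Space N] [CompactSpace M] [CompactSpace N] [IsManifold (𝓡∂ (n + 1)) ∞ M]
  [IsManifold (𝓡∂ (n + 1)) ∞ N] [IsManifold (𝓡 (n + 1)) ∞ P] [IsManifold (𝓡 (n + 1)) ∞ P'] in
/-- The lower slab of `T'` lies in the second piece of `P'`. [folklore] -/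
theorem toFun'_mem_range_jB (x : bM.carrier) {t : ℝ} (ht : t ∈ Ioc (-Fr.δ) 0) :
    T'.toFun (x, t) ∈ range G'.jB :=
  T'.toFun_mem_range_jB x ⟨by linarith [ht.1, Fr.δ_le'], ht.2⟩

omit [T2Space M] [T2Space N] [CompactSpace M] [CompactSpace N] [IsManifold (𝓡∂ (n + 1)) ∞ M]
  [IsManifold (𝓡∂ (n + 1)) ∞ N] [IsManifold (𝓡 (n + 1)) ∞ P] [IsManifold (𝓡 (n + 1)) ∞ P'] in
/-- The lower slab of `T` lies in the second piece of `P`. [folklore] -/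
theorem toFun_mem_range_jB (x : bM.carrier) {t : ℝ} (ht : t ∈ Ioc (-Fr.δ) 0) :
    T.toFun (x, t) ∈ range G.jB :=
  T.toFun_mem_range_jB x ⟨by linarith [ht.1, Fr.δ_le], ht.2⟩

omit [T2Space M] [T2Space N] [CompactSpace M] [CompactSpace N] [IsManifold (𝓡∂ (n + 1)) ∞ M]
  [IsManifold (𝓡∂ (n + 1)) ∞ N] [IsManifold (𝓡 (n + 1)) ∞ P] [IsManifold (𝓡 (n + 1)) ∞ P'] in
/-- On the upper slab (of width `b`), `F⁻¹ ∘ T' = jA ∘ jA'⁻¹ ∘ T'`. [folklore] -/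
theorem compare'_toFun'_up [Nonempty M] (x : bM.carrier) {t : ℝ} (ht : t ∈ Ico 0 Fr.b) :
    G'.compare G (T'.toFun (x, t)) = G.jA (G'.invA (T'.toFun (x, t))) := by
  conv_lhs => rw [← G'.jA_invA (Fr.toFun'_mem_range_jA_b x ht)]
  exact G'.compare_jA G _

omit [T2Space M] [T2Space N] [CompactSpace M] [CompactSpace N] [IsManifold (𝓡∂ (n + 1)) ∞ M]
  [IsManifold (𝓡∂ (n + 1)) ∞ N] [IsManifold (𝓡 (n + 1)) ∞ P] [IsManifold (𝓡 (n + 1)) ∞ P'] in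
/-- On the upper slab, `F ∘ T = jA' ∘ jA⁻¹ ∘ T`. [folklore] -/
theorem compare_toFun_up [Nonempty M] (x : bM.carrier) {t : ℝ} (ht : t ∈ Ico 0 Fr.δ) :
    G.compare G' (T.toFun (x, t)) = G'.jA (G.invA (T.toFun (x, t))) := by
  conv_lhs => rw [← G.jA_invA (Fr.toFun_mem_range_jA x ht)]
  exact G.compare_jA G' _

omit [T2Space M] [T2Space N] [CompactSpace M] [CompactSpace N] [IsManifold (𝓡∂ (n + 1)) ∞ M]
  [IsManifold (𝓡∂ (n + 1)) ∞ N] [IsManifold (𝓡 (n + 1)) ∞ P] [IsManifold (𝓡 (n + 1)) ∞ P'] in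
/-- On the lower slab (of width `b`), `F⁻¹ ∘ T' = jB ∘ jB'⁻¹ ∘ T'`. [folklore] -/
theorem compare'_toFun'_down [Nonempty N] (x : bM.carrier) {t : ℝ} (ht : t ∈ Ioc (-Fr.b) 0) :
    G'.compare G (T'.toFun (x, t)) = G.jB (G'.invB (T'.toFun (x, t))) := by
  conv_lhs => rw [← G'.jB_invB (Fr.toFun'_mem_range_jB_b x ht)]
  exact G'.compare_jB G _

omit [T2Space M] [T2Space N] [CompactSpace M] [CompactSpace N] [IsManifold (𝓡∂ (n + 1)) ∞ M]
  [IsManifold (𝓡∂ (n + 1)) ∞ N] [IsManifold (𝓡 (n + 1)) ∞ P] [IsManifold (𝓡 (n + 1)) ∞ P'] in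
/-- On the lower slab, `F ∘ T = jB' ∘ jB⁻¹ ∘ T`. [folklore] -/
theorem compare_toFun_down [Nonempty N] (x : bM.carrier) {t : ℝ} (ht : t ∈ Ioc (-Fr.δ) 0) :
    G.compare G' (T.toFun (x, t)) = G'.jB (G.invB (T.toFun (x, t))) := by
  conv_lhs => rw [← G.jB_invB (Fr.toFun_mem_range_jB x ht)]
  exact G.compare_jB G' _

omit [T2Space M] [T2Space N] [CompactSpace M] [CompactSpace N] [IsManifold (𝓡∂ (n + 1)) ∞ M]
  [IsManifold (𝓡∂ (n + 1)) ∞ N] [IsManifold (𝓡 (n + 1)) ∞ P] [IsManifold (𝓡 (n + 1)) ∞ P'] in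
/-- **`Ψ̂ ∘ Γ̂ = id` on the two-sided slab of width `b`.** [folklore] -/
theorem psiHat_gamHat {q : bM.carrier × ℝ} (hq : q.2 ∈ Ioo (-Fr.b) Fr.b) :
    psiHat T T' (gamHat T T' q) = q := by
  obtain ⟨x, t⟩ := q
  have h1 : T.toFun (T.invFun (G'.compare G (T'.toFun (x, t)))) = G'.compare G (T'.toFun (x, t)) :=
    T.toFun_invFun _ (Fr.height_compare'_toFun' (q := (x, t)) hq)
  simp only [psiHat, gamHat, h1, compare_compare]
  exact T'.invFun_toFun x t ⟨by linarith [hq.1, Fr.b_le], hq.2.trans_le Fr.b_le⟩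

omit [T2Space M] [T2Space N] [CompactSpace M] [CompactSpace N] [IsManifold (𝓡∂ (n + 1)) ∞ M]
  [IsManifold (𝓡∂ (n + 1)) ∞ N] [IsManifold (𝓡 (n + 1)) ∞ P] [IsManifold (𝓡 (n + 1)) ∞ P'] in
/-- `(-δ, δ) ⊆ (-b, b)`. [folklore] -/
theorem mem_Ioo_b_of_mem_Ioo {t : ℝ} (ht : t ∈ Ioo (-Fr.δ) Fr.δ) : t ∈ Ioo (-Fr.b) Fr.b :=
  ⟨by linarith [ht.1, Fr.δ_le_b], ht.2.trans_le Fr.δ_le_b⟩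

omit [T2Space M] [T2Space N] [CompactSpace M] [CompactSpace N] [IsManifold (𝓡∂ (n + 1)) ∞ M]
  [IsManifold (𝓡∂ (n + 1)) ∞ N] [IsManifold (𝓡 (n + 1)) ∞ P] [IsManifold (𝓡 (n + 1)) ∞ P'] in
/-- **`Γ̂ ∘ Ψ̂ = id` on the two-sided slab.** [folklore] -/
theorem gamHat_psiHat {q : bM.carrier × ℝ} (hq : q.2 ∈ Ioo (-Fr.δ) Fr.δ) :
    gamHat T T' (psiHat T T' q) = q := by
  obtain ⟨x, t⟩ := q
  have hb := Fr.slab_fwd (x, t) hq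
  have h1 : T'.toFun (T'.invFun (G.compare G' (T.toFun (x, t)))) = G.compare G' (T.toFun (x, t)) :=
    T'.toFun_invFun _ ⟨by linarith [hb.1, Fr.b_le], hb.2.trans_le Fr.b_le⟩
  simp only [psiHat, gamHat, h1, compare_compare]
  exact T.invFun_toFun x t ⟨by linarith [hq.1, Fr.δ_le], hq.2.trans_le Fr.δ_le⟩

omit [T2Space M] [T2Space N] [CompactSpace M] [CompactSpace N] [IsManifold (𝓡∂ (n + 1)) ∞ M]
  [IsManifold (𝓡∂ (n + 1)) ∞ N] [IsManifold (𝓡 (n + 1)) ∞ P] [IsManifold (𝓡 (n + 1)) ∞ P'] in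
/-- `Γ̂` has nonnegative height on the upper slab. [folklore] -/
theorem gamHat_snd_nonneg (x : bM.carrier) {t : ℝ} (ht : t ∈ Ico 0 Fr.b) :
    0 ≤ (gamHat T T' (x, t)).2 := by
  rw [gamHat_snd, T.height_nonneg_iff, G'.compare_mem_range_jA_iff G]
  exact Fr.toFun'_mem_range_jA_b x ht

omit [T2Space M] [T2Space N] [CompactSpace M] [CompactSpace N] [IsManifold (𝓡∂ (n + 1)) ∞ M]
  [IsManifold (𝓡∂ (n + 1)) ∞ N] [IsManifold (𝓡 (n + 1)) ∞ P] [IsManifold (𝓡 (n + 1)) ∞ P'] in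
/-- `Ψ̂` has nonnegative height on the upper slab. [folklore] -/
theorem psiHat_snd_nonneg (x : bM.carrier) {t : ℝ} (ht : t ∈ Ico 0 Fr.δ) :
    0 ≤ (psiHat T T' (x, t)).2 := by
  rw [psiHat_snd, T'.height_nonneg_iff, G.compare_mem_range_jA_iff G']
  exact Fr.toFun_mem_range_jA x ht

omit [T2Space M] [T2Space N] [CompactSpace M] [CompactSpace N] [IsManifold (𝓡∂ (n + 1)) ∞ M]
  [IsManifold (𝓡∂ (n + 1)) ∞ N] [IsManifold (𝓡 (n + 1)) ∞ P] [IsManifold (𝓡 (n + 1)) ∞ P'] in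
/-- `Γ̂` has nonpositive height on the lower slab. [folklore] -/
theorem gamHat_snd_nonpos (x : bM.carrier) {t : ℝ} (ht : t ∈ Ioc (-Fr.b) 0) :
    (gamHat T T' (x, t)).2 ≤ 0 := by
  rw [gamHat_snd, T.height_nonpos_iff, G'.compare_mem_range_jB_iff G]
  exact Fr.toFun'_mem_range_jB_b x ht

omit [T2Space M] [T2Space N] [CompactSpace M] [CompactSpace N] [IsManifold (𝓡∂ (n + 1)) ∞ M]
  [IsManifold (𝓡∂ (n + 1)) ∞ N] [IsManifold (𝓡 (n + 1)) ∞ P] [IsManifold (𝓡 (n + 1)) ∞ P'] in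
/-- `Ψ̂` has nonpositive height on the lower slab. [folklore] -/
theorem psiHat_snd_nonpos (x : bM.carrier) {t : ℝ} (ht : t ∈ Ioc (-Fr.δ) 0) :
    (psiHat T T' (x, t)).2 ≤ 0 := by
  rw [psiHat_snd, T'.height_nonpos_iff, G.compare_mem_range_jB_iff G']
  exact Fr.toFun_mem_range_jB x ht

omit [T2Space M] [T2Space N] [CompactSpace M] [CompactSpace N] [IsManifold (𝓡∂ (n + 1)) ∞ N]
  [IsManifold (𝓡 (n + 1)) ∞ P] in
/-- **`Γ̂` is `C^∞` on the upper slab** (within): `Γ̂ = T⁻¹ ∘ jA ∘ (jA'⁻¹ ∘ T')` there, a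
composite of the smooth tube `T'`, the lift `jA'⁻¹` (smooth on `range jA'` in the within
sense), `jA` and the smooth inverse tube `T⁻¹`. [folklore] -/
theorem contMDiffOn_gamHat_up [Nonempty M] :
    ContMDiffOn ((𝓡 n).prod 𝓘(ℝ, ℝ)) ((𝓡 n).prod 𝓘(ℝ, ℝ)) ∞ (gamHat T T') (univ ×ˢ Ico 0 Fr.b) := by
  rintro ⟨x, t⟩ ⟨-, ht⟩
  have hmaps : MapsTo T'.toFun ((univ : Set bM.carrier) ×ˢ Ico 0 Fr.b) (range G'.jA) :=
    fun q hq => Fr.toFun'_mem_range_jA_b q.1 hq.2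
  have hc : ContMDiffWithinAt ((𝓡 n).prod 𝓘(ℝ, ℝ)) (𝓡∂ (n + 1)) ∞ (G'.invA ∘ T'.toFun)
      (univ ×ˢ Ico 0 Fr.b) (x, t) :=
    (G'.contMDiffOn_invA _ (hmaps ⟨mem_univ _, ht⟩)).comp (x, t)
      (T'.contMDiff_toFun _).contMDiffWithinAt hmaps
  have hjc : ContMDiffWithinAt ((𝓡 n).prod 𝓘(ℝ, ℝ)) (𝓡 (n + 1)) ∞ (G.jA ∘ (G'.invA ∘ T'.toFun))
      (univ ×ˢ Ico 0 Fr.b) (x, t) :=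
    (G.contMDiff_jA _).comp_contMDiffWithinAt _ hc
  have hp : G.jA (G'.invA (T'.toFun (x, t))) = G'.compare G (T'.toFun (x, t)) :=
    (Fr.compare'_toFun'_up x ht).symm
  have hK : ContMDiffAt (𝓡 (n + 1)) ((𝓡 n).prod 𝓘(ℝ, ℝ)) ∞ T.invFun
      ((G.jA ∘ (G'.invA ∘ T'.toFun)) (x, t)) := by
    show ContMDiffAt _ _ _ _ (G.jA (G'.invA (T'.toFun (x, t))))
    rw [hp]
    exact T.contMDiffAt_invFun (Fr.height_compare'_toFun' (q := (x, t))
      ⟨by linarith [ht.1, Fr.b_pos], ht.2⟩)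
  refine (hK.comp_contMDiffWithinAt _ hjc).congr (fun q' hq' => ?_) ?_
  · show T.invFun (G'.compare G (T'.toFun q')) = T.invFun (G.jA (G'.invA (T'.toFun q')))
    rw [show q' = (q'.1, q'.2) from rfl, Fr.compare'_toFun'_up q'.1 hq'.2]
  · show T.invFun (G'.compare G (T'.toFun (x, t))) = T.invFun (G.jA (G'.invA (T'.toFun (x, t))))
    rw [Fr.compare'_toFun'_up x ht]

omit [T2Space M] [T2Space N] [CompactSpace M] [CompactSpace N] [IsManifold (𝓡∂ (n + 1)) ∞ N]
  [IsManifold (𝓡 (n + 1)) ∞ P'] in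
/-- **`Ψ̂` is `C^∞` on the upper slab** (within). [folklore] -/
theorem contMDiffOn_psiHat_up [Nonempty M] :
    ContMDiffOn ((𝓡 n).prod 𝓘(ℝ, ℝ)) ((𝓡 n).prod 𝓘(ℝ, ℝ)) ∞ (psiHat T T') (univ ×ˢ Ico 0 Fr.δ) := by
  rintro ⟨x, t⟩ ⟨-, ht⟩
  have hmaps : MapsTo T.toFun ((univ : Set bM.carrier) ×ˢ Ico 0 Fr.δ) (range G.jA) :=
    fun q hq => Fr.toFun_mem_range_jA q.1 hq.2
  have hc : ContMDiffWithinAt ((𝓡 n).prod 𝓘(ℝ, ℝ)) (𝓡∂ (n + 1)) ∞ (G.invA ∘ T.toFun)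
      (univ ×ˢ Ico 0 Fr.δ) (x, t) :=
    (G.contMDiffOn_invA _ (hmaps ⟨mem_univ _, ht⟩)).comp (x, t)
      (T.contMDiff_toFun _).contMDiffWithinAt hmaps
  have hjc : ContMDiffWithinAt ((𝓡 n).prod 𝓘(ℝ, ℝ)) (𝓡 (n + 1)) ∞ (G'.jA ∘ (G.invA ∘ T.toFun))
      (univ ×ˢ Ico 0 Fr.δ) (x, t) :=
    (G'.contMDiff_jA _).comp_contMDiffWithinAt _ hc
  have hp : G'.jA (G.invA (T.toFun (x, t))) = G.compare G' (T.toFun (x, t)) :=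
    (Fr.compare_toFun_up x ht).symm
  have hb := Fr.slab_fwd (x, t) (Fr.mem_Ioo_of_mem_Ico ht)
  have hK : ContMDiffAt (𝓡 (n + 1)) ((𝓡 n).prod 𝓘(ℝ, ℝ)) ∞ T'.invFun
      ((G'.jA ∘ (G.invA ∘ T.toFun)) (x, t)) := by
    show ContMDiffAt _ _ _ _ (G'.jA (G.invA (T.toFun (x, t))))
    rw [hp]
    exact T'.contMDiffAt_invFun ⟨by linarith [hb.1, Fr.b_le], hb.2.trans_le Fr.b_le⟩
  refine (hK.comp_contMDiffWithinAt _ hjc).congr (fun q' hq' => ?_) ?_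
  · show T'.invFun (G.compare G' (T.toFun q')) = T'.invFun (G'.jA (G.invA (T.toFun q')))
    rw [show q' = (q'.1, q'.2) from rfl, Fr.compare_toFun_up q'.1 hq'.2]
  · show T'.invFun (G.compare G' (T.toFun (x, t))) = T'.invFun (G'.jA (G.invA (T.toFun (x, t))))
    rw [Fr.compare_toFun_up x ht]

omit [T2Space M] [T2Space N] [CompactSpace M] [CompactSpace N] [IsManifold (𝓡∂ (n + 1)) ∞ M]
  [IsManifold (𝓡 (n + 1)) ∞ P] in
/-- **`Γ̂` is `C^∞` on the lower slab** (within), through the second pieces. [folklore] -/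
theorem contMDiffOn_gamHat_down [Nonempty N] :
    ContMDiffOn ((𝓡 n).prod 𝓘(ℝ, ℝ)) ((𝓡 n).prod 𝓘(ℝ, ℝ)) ∞ (gamHat T T') (univ ×ˢ Ioc (-Fr.b) 0) := by
  rintro ⟨x, t⟩ ⟨-, ht⟩
  have hmaps : MapsTo T'.toFun ((univ : Set bM.carrier) ×ˢ Ioc (-Fr.b) 0) (range G'.jB) :=
    fun q hq => Fr.toFun'_mem_range_jB_b q.1 hq.2
  have hc : ContMDiffWithinAt ((𝓡 n).prod 𝓘(ℝ, ℝ)) (𝓡∂ (n + 1)) ∞ (G'.invB ∘ T'.toFun)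
      (univ ×ˢ Ioc (-Fr.b) 0) (x, t) :=
    (G'.contMDiffOn_invB _ (hmaps ⟨mem_univ _, ht⟩)).comp (x, t)
      (T'.contMDiff_toFun _).contMDiffWithinAt hmaps
  have hjc : ContMDiffWithinAt ((𝓡 n).prod 𝓘(ℝ, ℝ)) (𝓡 (n + 1)) ∞ (G.jB ∘ (G'.invB ∘ T'.toFun))
      (univ ×ˢ Ioc (-Fr.b) 0) (x, t) :=
    (G.contMDiff_jB _).comp_contMDiffWithinAt _ hc
  have hp : G.jB (G'.invB (T'.toFun (x, t))) = G'.compare G (T'.toFun (x, t)) :=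
    (Fr.compare'_toFun'_down x ht).symm
  have hK : ContMDiffAt (𝓡 (n + 1)) ((𝓡 n).prod 𝓘(ℝ, ℝ)) ∞ T.invFun
      ((G.jB ∘ (G'.invB ∘ T'.toFun)) (x, t)) := by
    show ContMDiffAt _ _ _ _ (G.jB (G'.invB (T'.toFun (x, t))))
    rw [hp]
    exact T.contMDiffAt_invFun (Fr.height_compare'_toFun' (q := (x, t))
      ⟨ht.1, by linarith [ht.2, Fr.b_pos]⟩)
  refine (hK.comp_contMDiffWithinAt _ hjc).congr (fun q' hq' => ?_) ?_
  · show T.invFun (G'.compare G (T'.toFun q')) = T.invFun (G.jB (G'.invB (T'.toFun q')))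
    rw [show q' = (q'.1, q'.2) from rfl, Fr.compare'_toFun'_down q'.1 hq'.2]
  · show T.invFun (G'.compare G (T'.toFun (x, t))) = T.invFun (G.jB (G'.invB (T'.toFun (x, t))))
    rw [Fr.compare'_toFun'_down x ht]

omit [T2Space M] [T2Space N] [CompactSpace M] [CompactSpace N] [IsManifold (𝓡∂ (n + 1)) ∞ M]
  [IsManifold (𝓡 (n + 1)) ∞ P'] in
/-- **`Ψ̂` is `C^∞` on the lower slab** (within). [folklore] -/
theorem contMDiffOn_psiHat_down [Nonempty N] :
    ContMDiffOn ((𝓡 n).prod 𝓘(ℝ, ℝ)) ((𝓡 n).prod 𝓘(ℝ, ℝ)) ∞ (psiHat T T') (univ ×ˢ Ioc (-Fr.δ) 0) := by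
  rintro ⟨x, t⟩ ⟨-, ht⟩
  have hmaps : MapsTo T.toFun ((univ : Set bM.carrier) ×ˢ Ioc (-Fr.δ) 0) (range G.jB) :=
    fun q hq => Fr.toFun_mem_range_jB q.1 hq.2
  have hc : ContMDiffWithinAt ((𝓡 n).prod 𝓘(ℝ, ℝ)) (𝓡∂ (n + 1)) ∞ (G.invB ∘ T.toFun)
      (univ ×ˢ Ioc (-Fr.δ) 0) (x, t) :=
    (G.contMDiffOn_invB _ (hmaps ⟨mem_univ _, ht⟩)).comp (x, t)
      (T.contMDiff_toFun _).contMDiffWithinAt hmaps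
  have hjc : ContMDiffWithinAt ((𝓡 n).prod 𝓘(ℝ, ℝ)) (𝓡 (n + 1)) ∞ (G'.jB ∘ (G.invB ∘ T.toFun))
      (univ ×ˢ Ioc (-Fr.δ) 0) (x, t) :=
    (G'.contMDiff_jB _).comp_contMDiffWithinAt _ hc
  have hp : G'.jB (G.invB (T.toFun (x, t))) = G.compare G' (T.toFun (x, t)) :=
    (Fr.compare_toFun_down x ht).symm
  have hb := Fr.slab_fwd (x, t) (Fr.mem_Ioo_of_mem_Ioc ht)
  have hK : ContMDiffAt (𝓡 (n + 1)) ((𝓡 n).prod 𝓘(ℝ, ℝ)) ∞ T'.invFun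
      ((G'.jB ∘ (G.invB ∘ T.toFun)) (x, t)) := by
    show ContMDiffAt _ _ _ _ (G'.jB (G.invB (T.toFun (x, t))))
    rw [hp]
    exact T'.contMDiffAt_invFun ⟨by linarith [hb.1, Fr.b_le], hb.2.trans_le Fr.b_le⟩
  refine (hK.comp_contMDiffWithinAt _ hjc).congr (fun q' hq' => ?_) ?_
  · show T'.invFun (G.compare G' (T.toFun q')) = T'.invFun (G'.jB (G.invB (T.toFun q')))
    rw [show q' = (q'.1, q'.2) from rfl, Fr.compare_toFun_down q'.1 hq'.2]
  · show T'.invFun (G.compare G' (T.toFun (x, t))) = T'.invFun (G'.jB (G.invB (T.toFun (x, t))))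
    rw [Fr.compare_toFun_down x ht]

omit [IsManifold (𝓡 (n + 1)) ∞ P] in
/-- **The upper height extension** `g̃₊ : P' → ℝ`, a `C^∞` function with
`g̃₊ ∘ jA' = f ∘ jA` (Seeley extension across the seam of `P'`,
`BoundaryGluingData.exists_contMDiff_comp_jA_eq`). [folklore] -/
def gUp (T : G.SeamTube) (G' : BoundaryGluingData bM bN φ P') : P' → ℝ :=
  Classical.choose (G'.exists_contMDiff_comp_jA_eq (g := T.height ∘ G.jA)
    (T.contMDiff_height.comp G.contMDiff_jA))

omit [IsManifold (𝓡 (n + 1)) ∞ P] in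
/-- `g̃₊` is smooth. [folklore] -/
theorem contMDiff_gUp (T : G.SeamTube) (G' : BoundaryGluingData bM bN φ P') :
    ContMDiff (𝓡 (n + 1)) 𝓘(ℝ, ℝ) ∞ (gUp T G') :=
  (Classical.choose_spec (G'.exists_contMDiff_comp_jA_eq (g := T.height ∘ G.jA)
    (T.contMDiff_height.comp G.contMDiff_jA))).1

omit [IsManifold (𝓡 (n + 1)) ∞ P] in
/-- `g̃₊ (jA' a) = f (jA a)`. [folklore] -/
theorem gUp_jA (T : G.SeamTube) (G' : BoundaryGluingData bM bN φ P') (a : M) :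
    gUp T G' (G'.jA a) = T.height (G.jA a) :=
  (Classical.choose_spec (G'.exists_contMDiff_comp_jA_eq (g := T.height ∘ G.jA)
    (T.contMDiff_height.comp G.contMDiff_jA))).2 a

omit [IsManifold (𝓡 (n + 1)) ∞ P] in
/-- **The lower height extension** `g̃₋ : P' → ℝ` with `g̃₋ ∘ jB' = f ∘ jB`. [folklore] -/
def gDown (T : G.SeamTube) (G' : BoundaryGluingData bM bN φ P') : P' → ℝ :=
  Classical.choose (G'.exists_contMDiff_comp_jB_eq (g := T.height ∘ G.jB)
    (T.contMDiff_height.comp G.contMDiff_jB))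

omit [IsManifold (𝓡 (n + 1)) ∞ P] in
/-- `g̃₋` is smooth. [folklore] -/
theorem contMDiff_gDown (T : G.SeamTube) (G' : BoundaryGluingData bM bN φ P') :
    ContMDiff (𝓡 (n + 1)) 𝓘(ℝ, ℝ) ∞ (gDown T G') :=
  (Classical.choose_spec (G'.exists_contMDiff_comp_jB_eq (g := T.height ∘ G.jB)
    (T.contMDiff_height.comp G.contMDiff_jB))).1

omit [IsManifold (𝓡 (n + 1)) ∞ P] in
/-- `g̃₋ (jB' b) = f (jB b)`. [folklore] -/
theorem gDown_jB (T : G.SeamTube) (G' : BoundaryGluingData bM bN φ P') (b : N) :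
    gDown T G' (G'.jB b) = T.height (G.jB b) :=
  (Classical.choose_spec (G'.exists_contMDiff_comp_jB_eq (g := T.height ∘ G.jB)
    (T.contMDiff_height.comp G.contMDiff_jB))).2 b

omit [IsManifold (𝓡 (n + 1)) ∞ P] in
/-- **The height of `Γ̂` on the upper slab is `g̃₊ ∘ T'`.** [folklore] -/
theorem gUp_toFun' [Nonempty M] (x : bM.carrier) {t : ℝ} (ht : t ∈ Ico 0 Fr.b) :
    gUp T G' (T'.toFun (x, t)) = (gamHat T T' (x, t)).2 := by
  rw [gamHat_snd, Fr.compare'_toFun'_up x ht]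
  conv_lhs => rw [← G'.jA_invA (Fr.toFun'_mem_range_jA_b x ht)]
  exact gUp_jA T G' _

omit [IsManifold (𝓡 (n + 1)) ∞ P] in
/-- **The height of `Γ̂` on the lower slab is `g̃₋ ∘ T'`.** [folklore] -/
theorem gDown_toFun' [Nonempty N] (x : bM.carrier) {t : ℝ} (ht : t ∈ Ioc (-Fr.b) 0) :
    gDown T G' (T'.toFun (x, t)) = (gamHat T T' (x, t)).2 := by
  rw [gamHat_snd, Fr.compare'_toFun'_down x ht]
  conv_lhs => rw [← G'.jB_invB (Fr.toFun'_mem_range_jB_b x ht)]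
  exact gDown_jB T G' _

/-- **The upper collar germ of the comparison map**: `(Γ̂, Ψ̂)` on `∂M × [0, δ)` with height
`g̃₊ ∘ T'`. [folklore] -/
def germUp [Nonempty M] (Fr : ComparisonFrame T T') : CollarGerm n bM.carrier where
  Γ := gamHat T T'
  Ψ := psiHat T T'
  height := gUp T G' ∘ T'.toFun
  δ := Fr.δ
  δ_pos := Fr.δ_pos
  contMDiffOn_Γ := Fr.contMDiffOn_gamHat_up.mono (prod_mono Subset.rfl (Ico_subset_Ico_right Fr.δ_le_b))
  contMDiffOn_Ψ := Fr.contMDiffOn_psiHat_up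
  contMDiff_height := (contMDiff_gUp T G').comp T'.contMDiff_toFun
  Γ_zero := gamHat_zero T T'
  Ψ_zero := psiHat_zero T T'
  Γ_snd_nonneg x _ ht := Fr.gamHat_snd_nonneg x ⟨ht.1, ht.2.trans_le Fr.δ_le_b⟩
  Ψ_snd_nonneg x _ ht := Fr.psiHat_snd_nonneg x ht
  Ψ_Γ _ _ ht _ := Fr.psiHat_gamHat (Fr.mem_Ioo_b_of_mem_Ioo (Fr.mem_Ioo_of_mem_Ico ht))
  Γ_Ψ _ _ ht _ := Fr.gamHat_psiHat (Fr.mem_Ioo_of_mem_Ico ht)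
  height_eq x _ ht := Fr.gUp_toFun' x ⟨ht.1, ht.2.trans_le Fr.δ_le_b⟩

/-- **The lower collar germ of the comparison map**, conjugated into the upper half cylinder
by the reflection `(x, t) ↦ (x, -t)`, with height `-(g̃₋ ∘ T' ∘ refl)`. [folklore] -/
def germDown [Nonempty N] (Fr : ComparisonFrame T T') : CollarGerm n bM.carrier where
  Γ := reflT ∘ gamHat T T' ∘ reflT
  Ψ := reflT ∘ psiHat T T' ∘ reflT
  height q := -(gDown T G' (T'.toFun (reflT q)))
  δ := Fr.δ
  δ_pos := Fr.δ_pos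
  contMDiffOn_Γ := by
    refine contMDiff_reflT.comp_contMDiffOn (Fr.contMDiffOn_gamHat_down.comp
      contMDiff_reflT.contMDiffOn fun q hq => ⟨mem_univ _, ?_⟩)
    show -q.2 ∈ Ioc (-Fr.b) 0
    exact ⟨by linarith [hq.2.2, Fr.δ_le_b], by linarith [hq.2.1]⟩
  contMDiffOn_Ψ := by
    refine contMDiff_reflT.comp_contMDiffOn (Fr.contMDiffOn_psiHat_down.comp
      contMDiff_reflT.contMDiffOn fun q hq => ⟨mem_univ _, ?_⟩)
    show -q.2 ∈ Ioc (-Fr.δ) 0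
    exact ⟨by linarith [hq.2.2], by linarith [hq.2.1]⟩
  contMDiff_height :=
    contDiff_neg.comp_contMDiff ((contMDiff_gDown T G').comp (T'.contMDiff_toFun.comp contMDiff_reflT))
  Γ_zero x := by simp [reflT, gamHat_zero]
  Ψ_zero x := by simp [reflT, psiHat_zero]
  Γ_snd_nonneg x t ht := by
    show 0 ≤ -(gamHat T T' (x, -t)).2
    have := Fr.gamHat_snd_nonpos x (t := -t) ⟨by linarith [ht.2, Fr.δ_le_b], by linarith [ht.1]⟩
    linarith
  Ψ_snd_nonneg x t ht := by
    show 0 ≤ -(psiHat T T' (x, -t)).2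
    have := Fr.psiHat_snd_nonpos x (t := -t) ⟨by linarith [ht.2], by linarith [ht.1]⟩
    linarith
  Ψ_Γ x t ht _ := by
    show reflT (psiHat T T' (reflT (reflT (gamHat T T' (reflT (x, t)))))) = (x, t)
    rw [reflT_reflT, show reflT (bM := bM) (x, t) = (x, -t) from rfl,
      Fr.psiHat_gamHat (q := (x, -t)) ⟨by linarith [ht.2, Fr.δ_le_b], by linarith [ht.1, Fr.b_pos]⟩]
    simp [reflT]
  Γ_Ψ x t ht _ := by
    show reflT (gamHat T T' (reflT (reflT (psiHat T T' (reflT (x, t)))))) = (x, t)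
    rw [reflT_reflT, show reflT (bM := bM) (x, t) = (x, -t) from rfl,
      Fr.gamHat_psiHat (q := (x, -t)) ⟨by linarith [ht.2], by linarith [ht.1, Fr.δ_pos]⟩]
    simp [reflT]
  height_eq x t ht := by
    show -(gDown T G' (T'.toFun (x, -t))) = (reflT (gamHat T T' (reflT (x, t)))).2
    rw [Fr.gDown_toFun' x (t := -t) ⟨by linarith [ht.2, Fr.δ_le_b], by linarith [ht.1]⟩]
    simp [reflT]

/-- The germ of `germUp` (definitional). [folklore] -/
@[simp] theorem germUp_Γ [Nonempty M] : Fr.germUp.Γ = gamHat T T' := rfl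

/-- The inverse germ of `germUp` (definitional). [folklore] -/
@[simp] theorem germUp_Ψ [Nonempty M] : Fr.germUp.Ψ = psiHat T T' := rfl

/-- The width of `germUp` (definitional). [folklore] -/
@[simp] theorem germUp_δ [Nonempty M] : Fr.germUp.δ = Fr.δ := rfl

/-- The germ of `germDown` (definitional). [folklore] -/
@[simp] theorem germDown_Γ [Nonempty N] : Fr.germDown.Γ = reflT ∘ gamHat T T' ∘ reflT := rfl

/-- The inverse germ of `germDown` (definitional). [folklore] -/
@[simp] theorem germDown_Ψ [Nonempty N] : Fr.germDown.Ψ = reflT ∘ psiHat T T' ∘ reflT := rfl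

/-- The width of `germDown` (definitional). [folklore] -/
@[simp] theorem germDown_δ [Nonempty N] : Fr.germDown.δ = Fr.δ := rfl

end ComparisonFrame

end GermConstruction

end BoundaryGluingData

end Literature.Topology.FourManifolds
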